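import Summits.QuantumFields.YangMills.Theorems.UnitScaleTiltProp7Taylor3Word
import Summits.QuantumFields.YangMills.Theorems.UnitScaleTiltProp7ExactClause1
import HarnessLib

/-!
# Route `UnitScaleTilt`, crux K1 child «MinimiserStabilityRegPr» (stmt-QuantumFields-19200), skeleton v10, stub `stub_existenceMinimalOrbit`, route (α) (S3)(ii) GROWTH —
# T3W PART 2: THE ACTION-LEVEL TAYLOR3_W ROW OF THE EXPONENTIAL CHART `D ↦ A(e^{iD}W)` — SECOND-ORDER TAYLOR POLYNOMIAL IN THE CELL's LETTERS, THIRD-ORDER REMAINDER PROVED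

Cell `ym3-torus`, width seat `ym-ust-19200-w4` (gen 2; OWNER 2026-08-28 02:30:53Z ∕ 02:33:35Z successor socket (σ-1) T3W; RULING (HESS_W) 02:40:40Z DEPMAP: GROWTH ⇐ CHART_W +
TAYLOR3_W (this file) + EL_W + HESS_W [✓ p483802 ∘ p519482 at full Landau] + (FV-u)).  THEOREMS ONLY (0 `def`, 0 `sorry`).  YM₃ on T³ is a ladder rung (R3), not the Clay
problem; nothing here claims the stub, the crux, d = 4 or the mass gap.

THE ROW.  `Prop7Growth142T3Chart.growth142_T3_chart(_approxEL)` displays TAYLOR3_W as `hT : ∀ δ ∈ S, ‖δ‖ ≤ ρ → −(C·ρ·‖δ‖²) ≤ f δ − f 0 − ℓ δ − q δ`.  For the naive exponential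
chart `f(D) = A(e^{iD}W)` at ANY configuration `W` this file PROVES it with the first and second differentials written in the cell's letters (Part 1's transported `Z_k`,
`ℒ_p = Z₁ + Z₂ − Z₃ − Z₄`, exact quadratic part `𝒬_p`):
  `ℓ_W(D) = Σ_p ½Re Tr((W(∂p) − 1)^*·ℒ_p·W(∂p))`  — the cell's exact first-order functional `Lin_W` at `Y := iD`;
  `q_W(D) = Σ_p [½‖ℒ_p‖² + ½Re Tr((W(∂p) − 1)^*·𝒬_p·W(∂p))]`  — from p1's exact identity `A(U) − A(W) = Σ_p ½‖R_p − 1‖² + Σ_p ½Re Tr((W(∂p)−1)^*(R_p − 1)W(∂p))`;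
  ★ `|A(e^{iD}W) − A(W) − ℓ_W(D) − q_W(D)| ≤ 4800·s·Σ_b‖D(b)‖²` for `‖D(b)‖ ≤ s ≤ ¼` — i.e. `hT` with `C·ρ := 4800·s` against the `ℓ²`-size (the sup radius `s` and the
  `ℓ²`-norm are the two scales of (141)–(142); the abstract lemma takes `S ∩ {sup ≤ s}` as its slice).
§7 is the junction with p1's `Y`-currency: `|Lin_W(Y) − ℓ_W(D)| ≤ 12a·Σ_b‖D(b)‖²` at `Y = e^{iD} − 1` over a background with plaquettes within `a` of `1`, so that
`A(e^{iD}W) − A(W) − ℓ_W(D) = [A(U) − A(W) − Lin_W(Y)] + [Lin_W(Y) − ℓ_W(D)]` turns a growth bound in p1's currency (HESS_W of record: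
`Prop7CovariantCoercivity.wilsonAction4_sub_background_ge_offKernel_T3` at the chosen representative) into the chart row with approximate-EL constant `λ := 12a`.

WHAT IS PROVED (ns `…Theorems.Prop7Taylor3Word`).  §5 `norm_relPlaq_expChart_sub_lin_sub_quad_le` (per plaquette on the lattice: `‖R_p − 1 − ℒ_p − 𝒬_p‖ ≤ 4(Σ_{∂p}‖D‖)³`);
§6 `abs_sq_norm_sub_sq_norm_le`, `cubic_bookkeeping`, `abs_plaq_action_sub_taylor2_le` (abstract, `25σ³` per plaquette), `cube_sum_le`,
★ `abs_wilsonAction4_expChart_sub_taylor2_le`, `neg_le_wilsonAction4_expChart_sub_taylor2` (the `hT` shape); §7 `norm_lin_sub_lin_le`, ★ `abs_lin_pertY_sub_lin_chart_le`.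

HONEST SCOPE.  Bookkeeping over Part 1, p1's exact action identity and g0's chart rows; absolute constants, no smallness of the background needed for §5–§6; nothing of
[Balaban1985Variational] is asserted; `--supports stmt-QuantumFields-19200`, count-neutral.  Not a claim about the continuum limit or the mass gap.

References: T. Bałaban, CMP 102 (1985) 277–309 [Balaban1985Variational] ((22)–(31) pp.281–283, (112) p.294, (141)–(143) p.299).
-/

set_option autoImplicit false

noncomputable section

open scoped BigOperators Matrix.Norms.L2Operator Matrix

namespace Summit.QuantumFields.YangMills.Theorems.Prop7Taylor3Word

open NormedSpace
open Literature.MathematicalPhysics.QuantumFieldTheory.Balaban1983to89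
open Literature.MathematicalPhysics.QuantumFieldTheory.Balaban1983to89.T3ContinuumYM3Torus
open Literature.MathematicalPhysics.QuantumFieldTheory.Balaban1983to89.T3SectALandauChart (emb15)
open Summit.QuantumFields.YangMills.Theorems.Prop7TPrint (expHerm coe_expHerm expHermField expHermField_apply)
open Summit.QuantumFields.YangMills.Theorems.Prop7Taylor3ExpChart (norm_I_smul)
open Summit.QuantumFields.YangMills.Theorems.Prop7CovariantCoercivity (plaqHol_eq_word)
open Summit.QuantumFields.YangMills.Theorems.PerturbedPlaquette (norm_conj_SU)
open Summit.QuantumFields.YangMills.Theorems.Prop7ExactExpansion (wilsonAction4_sub_eq_relPlaq abs_half_re_trace_sub_le)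
open Summit.QuantumFields.YangMills.Theorems.Prop7FlatLocalMin (sum_plaq_bonds_le)

/-! ## §5 On the lattice, per plaquette: the relative plaquette variable of `e^{iD}W` against `W(∂p)` to second order -/

section Lattice

variable {F : T3Family} {K : ℕ}

/-- **THE RELATIVE PLAQUETTE VARIABLE OF THE CHART POINT `e^{iD}W` TO SECOND ORDER, PER PLAQUETTE**: for `D` Hermitian traceless with `‖D(b)‖ ≤ 1`, with the transported
letters `Z₁ = iD(b₁)`, `Z₂ = W(b₁)(iD(b₂))W(b₁)^*`, `Z₃ = Q(iD(b₃))Q^*` (`Q = W(b₁)W(b₂)W(b₃)⁻¹`), `Z₄ = W(∂p)(iD(b₄))W(∂p)^*` (the cell's `Lin` letters at `Y := iD`):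
`‖(e^{iD}W)(∂p)·W(∂p)^* − 1 − ℒ_p − 𝒬_p‖ ≤ 4(Σ_{b∈∂p}‖D(b)‖)³`, `ℒ_p = Z₁ + Z₂ − Z₃ − Z₄`, `𝒬_p = ½ΣZ_k² + Z₁Z₂ − Z₁Z₃ − Z₁Z₄ − Z₂Z₃ − Z₂Z₄ + Z₃Z₄`.
[cite: Balaban1985Variational, (22)-(26) pp.281-282, (112) p.294, (141)-(142) p.299] -/
theorem norm_relPlaq_expChart_sub_lin_sub_quad_le (W : GaugeField (F.P K) 0 (Matrix.specialUnitaryGroup (Fin 2) ℂ)) (D : PBond (F.P K) 0 → Matrix (Fin 2) (Fin 2) ℂ)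
    (p : Plaq (F.P K) 0) (hD : ∀ b : PBond (F.P K) 0, (D b).IsHermitian ∧ Matrix.trace (D b) = 0) (h1 : ∀ b : PBond (F.P K) 0, ‖D b‖ ≤ 1) :
    ‖(((GaugeField.plaqHol (emb15 W (expHermField D)) p : Matrix.specialUnitaryGroup (Fin 2) ℂ) : Matrix (Fin 2) (Fin 2) ℂ) * star ((GaugeField.plaqHol W p : Matrix.specialUnitaryGroup (Fin 2) ℂ) : Matrix (Fin 2) (Fin 2) ℂ) - 1)
        - ((Complex.I • D ⟨p.src, p.μ⟩) + ((W ⟨p.src, p.μ⟩ : Matrix (Fin 2) (Fin 2) ℂ) * (Complex.I • D ⟨p.src.shift p.μ, p.ν⟩) * star (W ⟨p.src, p.μ⟩ : Matrix (Fin 2) (Fin 2) ℂ))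
            - (((W ⟨p.src, p.μ⟩ * W ⟨p.src.shift p.μ, p.ν⟩ * (W ⟨p.src.shift p.ν, p.μ⟩)⁻¹ : Matrix.specialUnitaryGroup (Fin 2) ℂ) : Matrix (Fin 2) (Fin 2) ℂ) * (Complex.I • D ⟨p.src.shift p.ν, p.μ⟩) * star ((W ⟨p.src, p.μ⟩ * W ⟨p.src.shift p.μ, p.ν⟩ * (W ⟨p.src.shift p.ν, p.μ⟩)⁻¹ : Matrix.specialUnitaryGroup (Fin 2) ℂ) : Matrix (Fin 2) (Fin 2) ℂ))
            - (((GaugeField.plaqHol W p : Matrix.specialUnitaryGroup (Fin 2) ℂ) : Matrix (Fin 2) (Fin 2) ℂ) * (Complex.I • D ⟨p.src, p.ν⟩) * star ((GaugeField.plaqHol W p : Matrix.specialUnitaryGroup (Fin 2) ℂ) : Matrix (Fin 2) (Fin 2) ℂ)))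
        - ((2 : ℂ)⁻¹ • ((Complex.I • D ⟨p.src, p.μ⟩) ^ 2 + ((W ⟨p.src, p.μ⟩ : Matrix (Fin 2) (Fin 2) ℂ) * (Complex.I • D ⟨p.src.shift p.μ, p.ν⟩) * star (W ⟨p.src, p.μ⟩ : Matrix (Fin 2) (Fin 2) ℂ)) ^ 2
              + (((W ⟨p.src, p.μ⟩ * W ⟨p.src.shift p.μ, p.ν⟩ * (W ⟨p.src.shift p.ν, p.μ⟩)⁻¹ : Matrix.specialUnitaryGroup (Fin 2) ℂ) : Matrix (Fin 2) (Fin 2) ℂ) * (Complex.I • D ⟨p.src.shift p.ν, p.μ⟩) * star ((W ⟨p.src, p.μ⟩ * W ⟨p.src.shift p.μ, p.ν⟩ * (W ⟨p.src.shift p.ν, p.μ⟩)⁻¹ : Matrix.specialUnitaryGroup (Fin 2) ℂ) : Matrix (Fin 2) (Fin 2) ℂ)) ^ 2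
              + (((GaugeField.plaqHol W p : Matrix.specialUnitaryGroup (Fin 2) ℂ) : Matrix (Fin 2) (Fin 2) ℂ) * (Complex.I • D ⟨p.src, p.ν⟩) * star ((GaugeField.plaqHol W p : Matrix.specialUnitaryGroup (Fin 2) ℂ) : Matrix (Fin 2) (Fin 2) ℂ)) ^ 2)
            + (Complex.I • D ⟨p.src, p.μ⟩) * ((W ⟨p.src, p.μ⟩ : Matrix (Fin 2) (Fin 2) ℂ) * (Complex.I • D ⟨p.src.shift p.μ, p.ν⟩) * star (W ⟨p.src, p.μ⟩ : Matrix (Fin 2) (Fin 2) ℂ))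
            - (Complex.I • D ⟨p.src, p.μ⟩) * (((W ⟨p.src, p.μ⟩ * W ⟨p.src.shift p.μ, p.ν⟩ * (W ⟨p.src.shift p.ν, p.μ⟩)⁻¹ : Matrix.specialUnitaryGroup (Fin 2) ℂ) : Matrix (Fin 2) (Fin 2) ℂ) * (Complex.I • D ⟨p.src.shift p.ν, p.μ⟩) * star ((W ⟨p.src, p.μ⟩ * W ⟨p.src.shift p.μ, p.ν⟩ * (W ⟨p.src.shift p.ν, p.μ⟩)⁻¹ : Matrix.specialUnitaryGroup (Fin 2) ℂ) : Matrix (Fin 2) (Fin 2) ℂ))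
            - (Complex.I • D ⟨p.src, p.μ⟩) * (((GaugeField.plaqHol W p : Matrix.specialUnitaryGroup (Fin 2) ℂ) : Matrix (Fin 2) (Fin 2) ℂ) * (Complex.I • D ⟨p.src, p.ν⟩) * star ((GaugeField.plaqHol W p : Matrix.specialUnitaryGroup (Fin 2) ℂ) : Matrix (Fin 2) (Fin 2) ℂ))
            - ((W ⟨p.src, p.μ⟩ : Matrix (Fin 2) (Fin 2) ℂ) * (Complex.I • D ⟨p.src.shift p.μ, p.ν⟩) * star (W ⟨p.src, p.μ⟩ : Matrix (Fin 2) (Fin 2) ℂ))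
                * (((W ⟨p.src, p.μ⟩ * W ⟨p.src.shift p.μ, p.ν⟩ * (W ⟨p.src.shift p.ν, p.μ⟩)⁻¹ : Matrix.specialUnitaryGroup (Fin 2) ℂ) : Matrix (Fin 2) (Fin 2) ℂ) * (Complex.I • D ⟨p.src.shift p.ν, p.μ⟩) * star ((W ⟨p.src, p.μ⟩ * W ⟨p.src.shift p.μ, p.ν⟩ * (W ⟨p.src.shift p.ν, p.μ⟩)⁻¹ : Matrix.specialUnitaryGroup (Fin 2) ℂ) : Matrix (Fin 2) (Fin 2) ℂ))
            - ((W ⟨p.src, p.μ⟩ : Matrix (Fin 2) (Fin 2) ℂ) * (Complex.I • D ⟨p.src.shift p.μ, p.ν⟩) * star (W ⟨p.src, p.μ⟩ : Matrix (Fin 2) (Fin 2) ℂ))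
                * (((GaugeField.plaqHol W p : Matrix.specialUnitaryGroup (Fin 2) ℂ) : Matrix (Fin 2) (Fin 2) ℂ) * (Complex.I • D ⟨p.src, p.ν⟩) * star ((GaugeField.plaqHol W p : Matrix.specialUnitaryGroup (Fin 2) ℂ) : Matrix (Fin 2) (Fin 2) ℂ))
            + (((W ⟨p.src, p.μ⟩ * W ⟨p.src.shift p.μ, p.ν⟩ * (W ⟨p.src.shift p.ν, p.μ⟩)⁻¹ : Matrix.specialUnitaryGroup (Fin 2) ℂ) : Matrix (Fin 2) (Fin 2) ℂ) * (Complex.I • D ⟨p.src.shift p.ν, p.μ⟩) * star ((W ⟨p.src, p.μ⟩ * W ⟨p.src.shift p.μ, p.ν⟩ * (W ⟨p.src.shift p.ν, p.μ⟩)⁻¹ : Matrix.specialUnitaryGroup (Fin 2) ℂ) : Matrix (Fin 2) (Fin 2) ℂ))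
                * (((GaugeField.plaqHol W p : Matrix.specialUnitaryGroup (Fin 2) ℂ) : Matrix (Fin 2) (Fin 2) ℂ) * (Complex.I • D ⟨p.src, p.ν⟩) * star ((GaugeField.plaqHol W p : Matrix.specialUnitaryGroup (Fin 2) ℂ) : Matrix (Fin 2) (Fin 2) ℂ)))‖
      ≤ 4 * (‖D ⟨p.src, p.μ⟩‖ + ‖D ⟨p.src.shift p.μ, p.ν⟩‖ + ‖D ⟨p.src.shift p.ν, p.μ⟩‖ + ‖D ⟨p.src, p.ν⟩‖) ^ 3 := by
  have hW : GaugeField.plaqHol W p = W ⟨p.src, p.μ⟩ * W ⟨p.src.shift p.μ, p.ν⟩ * (W ⟨p.src.shift p.ν, p.μ⟩)⁻¹ * (W ⟨p.src, p.ν⟩)⁻¹ := plaqHol_eq_word W p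
  have hU : GaugeField.plaqHol (emb15 W (expHermField D)) p
      = (expHerm (D ⟨p.src, p.μ⟩) * W ⟨p.src, p.μ⟩) * (expHerm (D ⟨p.src.shift p.μ, p.ν⟩) * W ⟨p.src.shift p.μ, p.ν⟩) * (expHerm (D ⟨p.src.shift p.ν, p.μ⟩) * W ⟨p.src.shift p.ν, p.μ⟩)⁻¹ * (expHerm (D ⟨p.src, p.ν⟩) * W ⟨p.src, p.ν⟩)⁻¹ :=
    plaqHol_eq_word _ p
  rw [hU, hW]
  exact norm_word_expChart_sub_lin_sub_quad_le (W ⟨p.src, p.μ⟩) (W ⟨p.src.shift p.μ, p.ν⟩) (W ⟨p.src.shift p.ν, p.μ⟩) (W ⟨p.src, p.ν⟩) (D ⟨p.src, p.μ⟩) (D ⟨p.src.shift p.μ, p.ν⟩) (D ⟨p.src.shift p.ν, p.μ⟩) (D ⟨p.src, p.ν⟩)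
    (hD _) (hD _) (hD _) (hD _) (h1 _) (h1 _) (h1 _) (h1 _)

end Lattice

/-! ## §6 The action level: the second-order Taylor polynomial of `D ↦ A(e^{iD}W)` at `D = 0` and its third-order remainder -/

section Action

/-- `|‖x‖² − ‖y‖²| ≤ ‖x − y‖·(‖x − y‖ + 2‖y‖)`. [folklore] -/
theorem abs_sq_norm_sub_sq_norm_le {E : Type*} [SeminormedAddCommGroup E] (x y : E) :
    |‖x‖ ^ 2 - ‖y‖ ^ 2| ≤ ‖x - y‖ * (‖x - y‖ + 2 * ‖y‖) := by
  have h1 : |‖x‖ - ‖y‖| ≤ ‖x - y‖ := abs_norm_sub_norm_le x y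
  have h2 : ‖x‖ ≤ ‖x - y‖ + ‖y‖ := by
    have := norm_add_le (x - y) y
    rwa [sub_add_cancel] at this
  rw [sq_sub_sq, abs_mul, abs_of_nonneg (by positivity : 0 ≤ ‖x‖ + ‖y‖), mul_comm]
  exact mul_le_mul h1 (by linarith) (by positivity) (norm_nonneg _)

/-- The cubic bookkeeping of the action-level remainder (`σ ≤ 1`). [folklore] -/
theorem cubic_bookkeeping {A B C σ : ℝ} (hσ0 : 0 ≤ σ) (hσ1 : σ ≤ 1) (hA0 : 0 ≤ A) (hA : A ≤ (1 / 2) * σ ^ 2 + 4 * σ ^ 3)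
    (hB0 : 0 ≤ B) (hB : B ≤ σ) (hC : C ≤ 4 * σ ^ 3) :
    (1 / 2) * (A * (A + 2 * B)) + 2 * C ≤ 25 * σ ^ 3 := by
  have s21 : σ ^ 2 ≤ σ := by nlinarith
  have s32 : σ ^ 3 ≤ σ ^ 2 := by nlinarith
  have hA' : A ≤ (9 / 2) * σ ^ 2 := by linarith
  have hAB : A + 2 * B ≤ (13 / 2) * σ := by nlinarith
  have hm := mul_le_mul hA' hAB (by positivity) (by positivity)
  nlinarith

/-- **THE ACTION-LEVEL REMAINDER PER PLAQUETTE, ABSTRACTLY**: for unitary `P₀ ∈ M₂(ℂ)` and letters `x` (relative plaquette variable minus `1`), `L` (linear part, `‖L‖ ≤ σ`),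
`Q` (quadratic part, `‖Q‖ ≤ ½σ²`) with `‖x − L − Q‖ ≤ 4σ³`, `σ ≤ 1`:
`|½‖x‖² + ½Re Tr((P₀−1)^* x P₀) − ½Re Tr((P₀−1)^* L P₀) − (½‖L‖² + ½Re Tr((P₀−1)^* Q P₀))| ≤ 25σ³`. [cite: Balaban1985Variational, (26)-(31) pp.282-283, (141)-(142) p.299] -/
theorem abs_plaq_action_sub_taylor2_le (P₀ x L Q : Matrix (Fin 2) (Fin 2) ℂ) (hP : P₀ ∈ Matrix.unitaryGroup (Fin 2) ℂ) {σ : ℝ} (hσ0 : 0 ≤ σ) (hσ1 : σ ≤ 1)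
    (hL : ‖L‖ ≤ σ) (hQ : ‖Q‖ ≤ (1 / 2) * σ ^ 2) (hR : ‖x - L - Q‖ ≤ 4 * σ ^ 3) :
    |(1 / 2) * ‖x‖ ^ 2 + (1 / 2) * (((P₀ - 1)ᴴ * (x * P₀)).trace).re - (1 / 2) * (((P₀ - 1)ᴴ * (L * P₀)).trace).re
        - ((1 / 2) * ‖L‖ ^ 2 + (1 / 2) * (((P₀ - 1)ᴴ * (Q * P₀)).trace).re)| ≤ 25 * σ ^ 3 := by
  have hlin : (1 / 2) * (((P₀ - 1)ᴴ * (x * P₀)).trace).re - (1 / 2) * (((P₀ - 1)ᴴ * (L * P₀)).trace).re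
        - (1 / 2) * (((P₀ - 1)ᴴ * (Q * P₀)).trace).re = (1 / 2) * (((P₀ - 1)ᴴ * ((x - L - Q) * P₀)).trace).re := by
    simp only [sub_mul, Matrix.mul_sub, Matrix.trace_sub, Complex.sub_re]; ring
  have e : (1 / 2) * ‖x‖ ^ 2 + (1 / 2) * (((P₀ - 1)ᴴ * (x * P₀)).trace).re - (1 / 2) * (((P₀ - 1)ᴴ * (L * P₀)).trace).re
        - ((1 / 2) * ‖L‖ ^ 2 + (1 / 2) * (((P₀ - 1)ᴴ * (Q * P₀)).trace).re)
      = (1 / 2) * (‖x‖ ^ 2 - ‖L‖ ^ 2) + (1 / 2) * (((P₀ - 1)ᴴ * ((x - L - Q) * P₀)).trace).re := by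
    rw [← hlin]; ring
  rw [e]
  have hpair : |(1 / 2) * (((P₀ - 1)ᴴ * ((x - L - Q) * P₀)).trace).re| ≤ ‖P₀ - 1‖ * ‖x - L - Q‖ := by
    have h0 := abs_half_re_trace_sub_le P₀ (x - L - Q) 0 hP
    rwa [zero_mul, mul_zero, Matrix.trace_zero, Complex.zero_re, mul_zero, sub_zero, sub_zero] at h0
  have hP1 : ‖P₀ - 1‖ ≤ 2 := by
    calc ‖P₀ - 1‖ ≤ ‖P₀‖ + ‖(1 : Matrix (Fin 2) (Fin 2) ℂ)‖ := norm_sub_le _ _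
      _ = 2 := by rw [CStarRing.norm_of_mem_unitary hP, CStarRing.norm_one]; norm_num
  have hsq := abs_sq_norm_sub_sq_norm_le x L
  have hxL : ‖x - L‖ ≤ (1 / 2) * σ ^ 2 + 4 * σ ^ 3 := by
    have hx : x - L = Q + (x - L - Q) := by abel
    rw [hx]; exact (norm_add_le _ _).trans (add_le_add hQ hR)
  have ha : |(1 / 2) * (‖x‖ ^ 2 - ‖L‖ ^ 2)| ≤ (1 / 2) * (‖x - L‖ * (‖x - L‖ + 2 * ‖L‖)) := by
    rw [abs_mul, abs_of_pos (by norm_num : (0 : ℝ) < 1 / 2)]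
    exact mul_le_mul_of_nonneg_left hsq (by norm_num)
  have hb : |(1 / 2) * (((P₀ - 1)ᴴ * ((x - L - Q) * P₀)).trace).re| ≤ 2 * ‖x - L - Q‖ :=
    hpair.trans (mul_le_mul_of_nonneg_right hP1 (norm_nonneg _))
  have hbk := cubic_bookkeeping hσ0 hσ1 (norm_nonneg (x - L)) hxL (norm_nonneg L) hL hR
  exact (abs_add_le _ _).trans (by linarith)


variable {F : T3Family} {K : ℕ}

/-- `σ_p³ ≤ 16s·Σ_{b∈∂p}‖D(b)‖²` when the four letters are `≤ s`. [folklore] -/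
theorem cube_sum_le {e₁ e₂ e₃ e₄ s : ℝ} (h₀₁ : 0 ≤ e₁) (h₀₂ : 0 ≤ e₂) (h₀₃ : 0 ≤ e₃) (h₀₄ : 0 ≤ e₄)
    (h₁ : e₁ ≤ s) (h₂ : e₂ ≤ s) (h₃ : e₃ ≤ s) (h₄ : e₄ ≤ s) :
    (e₁ + e₂ + e₃ + e₄) ^ 3 ≤ 16 * s * (e₁ ^ 2 + e₂ ^ 2 + e₃ ^ 2 + e₄ ^ 2) := by
  have hσ : e₁ + e₂ + e₃ + e₄ ≤ 4 * s := by linarith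
  have hcs : (e₁ + e₂ + e₃ + e₄) ^ 2 ≤ 4 * (e₁ ^ 2 + e₂ ^ 2 + e₃ ^ 2 + e₄ ^ 2) := by
    nlinarith [sq_nonneg (e₁ - e₂), sq_nonneg (e₁ - e₃), sq_nonneg (e₁ - e₄), sq_nonneg (e₂ - e₃), sq_nonneg (e₂ - e₄), sq_nonneg (e₃ - e₄)]
  have h0 : 0 ≤ e₁ + e₂ + e₃ + e₄ := by positivity
  calc (e₁ + e₂ + e₃ + e₄) ^ 3 = (e₁ + e₂ + e₃ + e₄) * (e₁ + e₂ + e₃ + e₄) ^ 2 := by ring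
    _ ≤ (4 * s) * (4 * (e₁ ^ 2 + e₂ ^ 2 + e₃ ^ 2 + e₄ ^ 2)) := mul_le_mul hσ hcs (sq_nonneg _) (h0.trans hσ)
    _ = 16 * s * (e₁ ^ 2 + e₂ ^ 2 + e₃ ^ 2 + e₄ ^ 2) := by ring
set_option maxHeartbeats 400000 in
/-- ★ **TAYLOR3_W FOR THE EXPONENTIAL CHART AT A BACKGROUND — THE SECOND-ORDER TAYLOR POLYNOMIAL OF `D ↦ A(e^{iD}W)` AND ITS THIRD-ORDER REMAINDER, IN THE CELL's
LETTERS.**  For `W` any configuration of the finest lattice and `D` Hermitian traceless with `‖D(b)‖ ≤ s ≤ ¼` on every bond: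
`|A(e^{iD}W) − A(W) − ℓ_W(D) − q_W(D)| ≤ 4800·s·Σ_b‖D(b)‖²`, where (sums over plaquettes, transported letters `Z₁ … Z₄` of §5, `ℒ_p = Z₁ + Z₂ − Z₃ − Z₄`,
`𝒬_p = ½ΣZ_k² + Z₁Z₂ − Z₁Z₃ − Z₁Z₄ − Z₂Z₃ − Z₂Z₄ + Z₃Z₄`):
* `ℓ_W(D) = Σ_p ½Re Tr((W(∂p) − 1)^*·ℒ_p·W(∂p))` — the cell's EXACT FIRST-ORDER FUNCTIONAL `Lin_W` (4th conjunct of the clause-1 schemata, `Prop7CovariantCoercivity` ∕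
  `Prop7ExactExpansion`) evaluated at the linear field `Y := iD`: the first differential of the action through the chart;
* `q_W(D) = Σ_p [½‖ℒ_p‖² + ½Re Tr((W(∂p) − 1)^*·𝒬_p·W(∂p))]` — the second differential (halved): the square of the linearised relative plaquette variable plus the pairing of the
  background curvature with the exact quadratic part of the plaquette word (from `Prop7ExactExpansion.wilsonAction4_sub_eq_relPlaq`).
This is the `hT` row (TAYLOR3_W) of `Prop7Growth142T3Chart.growth142_T3_chart(_approxEL)` for the naive exponential chart, with `C·ρ := 4800·s` against the `ℓ²`-size
`Σ_b‖D(b)‖²`; the constant is absolute (incidence `4d = 12`, `σ_p³ ≤ 16s·Σ_{∂p}‖D‖²`, `25` per plaquette). [cite: Balaban1985Variational, (141)-(142) p.299, (26)-(31) pp.282-283, (112) p.294] -/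
theorem abs_wilsonAction4_expChart_sub_taylor2_le (W : GaugeField (F.P K) 0 (Matrix.specialUnitaryGroup (Fin 2) ℂ)) (D : PBond (F.P K) 0 → Matrix (Fin 2) (Fin 2) ℂ)
    (hD : ∀ b : PBond (F.P K) 0, (D b).IsHermitian ∧ Matrix.trace (D b) = 0) {s : ℝ} (hs0 : 0 ≤ s) (hs : ∀ b : PBond (F.P K) 0, ‖D b‖ ≤ s)
    (hs4 : 4 * s ≤ 1) :
    |wilsonAction4 (emb15 W (expHermField D)) - wilsonAction4 W
        - ∑ p : Plaq (F.P K) 0, (1 / 2) * (((((GaugeField.plaqHol W p : Matrix.specialUnitaryGroup (Fin 2) ℂ) : Matrix (Fin 2) (Fin 2) ℂ) - 1)ᴴ * (((Complex.I • D ⟨p.src, p.μ⟩) + ((W ⟨p.src, p.μ⟩ : Matrix (Fin 2) (Fin 2) ℂ) * (Complex.I • D ⟨p.src.shift p.μ, p.ν⟩) * star (W ⟨p.src, p.μ⟩ : Matrix (Fin 2) (Fin 2) ℂ))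
            - (((W ⟨p.src, p.μ⟩ * W ⟨p.src.shift p.μ, p.ν⟩ * (W ⟨p.src.shift p.ν, p.μ⟩)⁻¹ : Matrix.specialUnitaryGroup (Fin 2) ℂ) : Matrix (Fin 2) (Fin 2) ℂ) * (Complex.I • D ⟨p.src.shift p.ν, p.μ⟩) * star ((W ⟨p.src, p.μ⟩ * W ⟨p.src.shift p.μ, p.ν⟩ * (W ⟨p.src.shift p.ν, p.μ⟩)⁻¹ : Matrix.specialUnitaryGroup (Fin 2) ℂ) : Matrix (Fin 2) (Fin 2) ℂ))
            - (((GaugeField.plaqHol W p : Matrix.specialUnitaryGroup (Fin 2) ℂ) : Matrix (Fin 2) (Fin 2) ℂ) * (Complex.I • D ⟨p.src, p.ν⟩) * star ((GaugeField.plaqHol W p : Matrix.specialUnitaryGroup (Fin 2) ℂ) : Matrix (Fin 2) (Fin 2) ℂ))) * ((GaugeField.plaqHol W p : Matrix.specialUnitaryGroup (Fin 2) ℂ) : Matrix (Fin 2) (Fin 2) ℂ))).trace).re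
        - ∑ p : Plaq (F.P K) 0, ((1 / 2) * ‖((Complex.I • D ⟨p.src, p.μ⟩) + ((W ⟨p.src, p.μ⟩ : Matrix (Fin 2) (Fin 2) ℂ) * (Complex.I • D ⟨p.src.shift p.μ, p.ν⟩) * star (W ⟨p.src, p.μ⟩ : Matrix (Fin 2) (Fin 2) ℂ))
            - (((W ⟨p.src, p.μ⟩ * W ⟨p.src.shift p.μ, p.ν⟩ * (W ⟨p.src.shift p.ν, p.μ⟩)⁻¹ : Matrix.specialUnitaryGroup (Fin 2) ℂ) : Matrix (Fin 2) (Fin 2) ℂ) * (Complex.I • D ⟨p.src.shift p.ν, p.μ⟩) * star ((W ⟨p.src, p.μ⟩ * W ⟨p.src.shift p.μ, p.ν⟩ * (W ⟨p.src.shift p.ν, p.μ⟩)⁻¹ : Matrix.specialUnitaryGroup (Fin 2) ℂ) : Matrix (Fin 2) (Fin 2) ℂ))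
            - (((GaugeField.plaqHol W p : Matrix.specialUnitaryGroup (Fin 2) ℂ) : Matrix (Fin 2) (Fin 2) ℂ) * (Complex.I • D ⟨p.src, p.ν⟩) * star ((GaugeField.plaqHol W p : Matrix.specialUnitaryGroup (Fin 2) ℂ) : Matrix (Fin 2) (Fin 2) ℂ)))‖ ^ 2
          + (1 / 2) * (((((GaugeField.plaqHol W p : Matrix.specialUnitaryGroup (Fin 2) ℂ) : Matrix (Fin 2) (Fin 2) ℂ) - 1)ᴴ * (((2 : ℂ)⁻¹ • ((Complex.I • D ⟨p.src, p.μ⟩) ^ 2 + ((W ⟨p.src, p.μ⟩ : Matrix (Fin 2) (Fin 2) ℂ) * (Complex.I • D ⟨p.src.shift p.μ, p.ν⟩) * star (W ⟨p.src, p.μ⟩ : Matrix (Fin 2) (Fin 2) ℂ)) ^ 2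
              + (((W ⟨p.src, p.μ⟩ * W ⟨p.src.shift p.μ, p.ν⟩ * (W ⟨p.src.shift p.ν, p.μ⟩)⁻¹ : Matrix.specialUnitaryGroup (Fin 2) ℂ) : Matrix (Fin 2) (Fin 2) ℂ) * (Complex.I • D ⟨p.src.shift p.ν, p.μ⟩) * star ((W ⟨p.src, p.μ⟩ * W ⟨p.src.shift p.μ, p.ν⟩ * (W ⟨p.src.shift p.ν, p.μ⟩)⁻¹ : Matrix.specialUnitaryGroup (Fin 2) ℂ) : Matrix (Fin 2) (Fin 2) ℂ)) ^ 2
              + (((GaugeField.plaqHol W p : Matrix.specialUnitaryGroup (Fin 2) ℂ) : Matrix (Fin 2) (Fin 2) ℂ) * (Complex.I • D ⟨p.src, p.ν⟩) * star ((GaugeField.plaqHol W p : Matrix.specialUnitaryGroup (Fin 2) ℂ) : Matrix (Fin 2) (Fin 2) ℂ)) ^ 2)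
            + (Complex.I • D ⟨p.src, p.μ⟩) * ((W ⟨p.src, p.μ⟩ : Matrix (Fin 2) (Fin 2) ℂ) * (Complex.I • D ⟨p.src.shift p.μ, p.ν⟩) * star (W ⟨p.src, p.μ⟩ : Matrix (Fin 2) (Fin 2) ℂ))
            - (Complex.I • D ⟨p.src, p.μ⟩) * (((W ⟨p.src, p.μ⟩ * W ⟨p.src.shift p.μ, p.ν⟩ * (W ⟨p.src.shift p.ν, p.μ⟩)⁻¹ : Matrix.specialUnitaryGroup (Fin 2) ℂ) : Matrix (Fin 2) (Fin 2) ℂ) * (Complex.I • D ⟨p.src.shift p.ν, p.μ⟩) * star ((W ⟨p.src, p.μ⟩ * W ⟨p.src.shift p.μ, p.ν⟩ * (W ⟨p.src.shift p.ν, p.μ⟩)⁻¹ : Matrix.specialUnitaryGroup (Fin 2) ℂ) : Matrix (Fin 2) (Fin 2) ℂ))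
            - (Complex.I • D ⟨p.src, p.μ⟩) * (((GaugeField.plaqHol W p : Matrix.specialUnitaryGroup (Fin 2) ℂ) : Matrix (Fin 2) (Fin 2) ℂ) * (Complex.I • D ⟨p.src, p.ν⟩) * star ((GaugeField.plaqHol W p : Matrix.specialUnitaryGroup (Fin 2) ℂ) : Matrix (Fin 2) (Fin 2) ℂ))
            - ((W ⟨p.src, p.μ⟩ : Matrix (Fin 2) (Fin 2) ℂ) * (Complex.I • D ⟨p.src.shift p.μ, p.ν⟩) * star (W ⟨p.src, p.μ⟩ : Matrix (Fin 2) (Fin 2) ℂ))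
                * (((W ⟨p.src, p.μ⟩ * W ⟨p.src.shift p.μ, p.ν⟩ * (W ⟨p.src.shift p.ν, p.μ⟩)⁻¹ : Matrix.specialUnitaryGroup (Fin 2) ℂ) : Matrix (Fin 2) (Fin 2) ℂ) * (Complex.I • D ⟨p.src.shift p.ν, p.μ⟩) * star ((W ⟨p.src, p.μ⟩ * W ⟨p.src.shift p.μ, p.ν⟩ * (W ⟨p.src.shift p.ν, p.μ⟩)⁻¹ : Matrix.specialUnitaryGroup (Fin 2) ℂ) : Matrix (Fin 2) (Fin 2) ℂ))
            - ((W ⟨p.src, p.μ⟩ : Matrix (Fin 2) (Fin 2) ℂ) * (Complex.I • D ⟨p.src.shift p.μ, p.ν⟩) * star (W ⟨p.src, p.μ⟩ : Matrix (Fin 2) (Fin 2) ℂ))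
                * (((GaugeField.plaqHol W p : Matrix.specialUnitaryGroup (Fin 2) ℂ) : Matrix (Fin 2) (Fin 2) ℂ) * (Complex.I • D ⟨p.src, p.ν⟩) * star ((GaugeField.plaqHol W p : Matrix.specialUnitaryGroup (Fin 2) ℂ) : Matrix (Fin 2) (Fin 2) ℂ))
            + (((W ⟨p.src, p.μ⟩ * W ⟨p.src.shift p.μ, p.ν⟩ * (W ⟨p.src.shift p.ν, p.μ⟩)⁻¹ : Matrix.specialUnitaryGroup (Fin 2) ℂ) : Matrix (Fin 2) (Fin 2) ℂ) * (Complex.I • D ⟨p.src.shift p.ν, p.μ⟩) * star ((W ⟨p.src, p.μ⟩ * W ⟨p.src.shift p.μ, p.ν⟩ * (W ⟨p.src.shift p.ν, p.μ⟩)⁻¹ : Matrix.specialUnitaryGroup (Fin 2) ℂ) : Matrix (Fin 2) (Fin 2) ℂ))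
                * (((GaugeField.plaqHol W p : Matrix.specialUnitaryGroup (Fin 2) ℂ) : Matrix (Fin 2) (Fin 2) ℂ) * (Complex.I • D ⟨p.src, p.ν⟩) * star ((GaugeField.plaqHol W p : Matrix.specialUnitaryGroup (Fin 2) ℂ) : Matrix (Fin 2) (Fin 2) ℂ))) * ((GaugeField.plaqHol W p : Matrix.specialUnitaryGroup (Fin 2) ℂ) : Matrix (Fin 2) (Fin 2) ℂ))).trace).re)|
      ≤ 4800 * s * ∑ b : PBond (F.P K) 0, ‖D b‖ ^ 2 := by
  have h1 : ∀ b : PBond (F.P K) 0, ‖D b‖ ≤ 1 := fun b => (hs b).trans (by linarith)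
  rw [wilsonAction4_sub_eq_relPlaq (emb15 W (expHermField D)) W, ← Finset.sum_sub_distrib, ← Finset.sum_sub_distrib]
  refine (Finset.abs_sum_le_sum_abs _ _).trans ?_
  -- incidence: each bond lies in `4d = 12` plaquette slots
  have hinc := sum_plaq_bonds_le (P := F.P K) (j := 0) (fun b => ‖D b‖ ^ 2) (fun b => sq_nonneg _)
  have hd : ((F.P K).d : ℝ) = 3 := by norm_num [T3Family.P_d]
  rw [hd] at hinc
  refine (Finset.sum_le_sum (g := fun p : Plaq (F.P K) 0 => 400 * s * (‖D ⟨p.src, p.μ⟩‖ ^ 2 + ‖D ⟨p.src.shift p.μ, p.ν⟩‖ ^ 2 + ‖D ⟨p.src.shift p.ν, p.μ⟩‖ ^ 2 + ‖D ⟨p.src, p.ν⟩‖ ^ 2))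
    fun p _ => ?_).trans ?_
  · -- per plaquette: §5 + the abstract action bookkeeping
    have n₁ : ‖(Complex.I • D ⟨p.src, p.μ⟩)‖ ≤ ‖D ⟨p.src, p.μ⟩‖ := (norm_I_smul _).le
    have n₂ : ‖((W ⟨p.src, p.μ⟩ : Matrix (Fin 2) (Fin 2) ℂ) * (Complex.I • D ⟨p.src.shift p.μ, p.ν⟩) * star (W ⟨p.src, p.μ⟩ : Matrix (Fin 2) (Fin 2) ℂ))‖ ≤ ‖D ⟨p.src.shift p.μ, p.ν⟩‖ := by
      rw [norm_conj_SU, norm_I_smul]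
    have n₃ : ‖(((W ⟨p.src, p.μ⟩ * W ⟨p.src.shift p.μ, p.ν⟩ * (W ⟨p.src.shift p.ν, p.μ⟩)⁻¹ : Matrix.specialUnitaryGroup (Fin 2) ℂ) : Matrix (Fin 2) (Fin 2) ℂ) * (Complex.I • D ⟨p.src.shift p.ν, p.μ⟩) * star ((W ⟨p.src, p.μ⟩ * W ⟨p.src.shift p.μ, p.ν⟩ * (W ⟨p.src.shift p.ν, p.μ⟩)⁻¹ : Matrix.specialUnitaryGroup (Fin 2) ℂ) : Matrix (Fin 2) (Fin 2) ℂ))‖ ≤ ‖D ⟨p.src.shift p.ν, p.μ⟩‖ := by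
      rw [norm_conj_SU, norm_I_smul]
    have n₄ : ‖(((GaugeField.plaqHol W p : Matrix.specialUnitaryGroup (Fin 2) ℂ) : Matrix (Fin 2) (Fin 2) ℂ) * (Complex.I • D ⟨p.src, p.ν⟩) * star ((GaugeField.plaqHol W p : Matrix.specialUnitaryGroup (Fin 2) ℂ) : Matrix (Fin 2) (Fin 2) ℂ))‖ ≤ ‖D ⟨p.src, p.ν⟩‖ := by
      rw [norm_conj_SU, norm_I_smul]
    have hL := norm_lin_le _ _ _ _ n₁ n₂ n₃ n₄
    have hQ := norm_quad_le _ _ _ _ (norm_nonneg _) (norm_nonneg _) (norm_nonneg _) (norm_nonneg _) n₁ n₂ n₃ n₄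
    have hR := norm_relPlaq_expChart_sub_lin_sub_quad_le W D p hD h1
    have hσ1 : (‖D ⟨p.src, p.μ⟩‖ + ‖D ⟨p.src.shift p.μ, p.ν⟩‖ + ‖D ⟨p.src.shift p.ν, p.μ⟩‖ + ‖D ⟨p.src, p.ν⟩‖) ≤ 1 := by
      linarith [hs ⟨p.src, p.μ⟩, hs ⟨p.src.shift p.μ, p.ν⟩, hs ⟨p.src.shift p.ν, p.μ⟩, hs ⟨p.src, p.ν⟩]
    have hcube := cube_sum_le (norm_nonneg (D ⟨p.src, p.μ⟩)) (norm_nonneg (D ⟨p.src.shift p.μ, p.ν⟩)) (norm_nonneg (D ⟨p.src.shift p.ν, p.μ⟩)) (norm_nonneg (D ⟨p.src, p.ν⟩))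
      (hs ⟨p.src, p.μ⟩) (hs ⟨p.src.shift p.μ, p.ν⟩) (hs ⟨p.src.shift p.ν, p.μ⟩) (hs ⟨p.src, p.ν⟩)
    refine (abs_plaq_action_sub_taylor2_le _ _ _ _ (GaugeField.plaqHol W p).2.1 (by positivity) hσ1 hL hQ hR).trans ?_
    linarith
  · rw [← Finset.mul_sum]
    have := mul_le_mul_of_nonneg_left hinc (show (0 : ℝ) ≤ 400 * s by positivity)
    linarith

/-- **THE `hT` ROW SHAPE**: the one-sided form `−(4800·s)·Σ_b‖D(b)‖² ≤ A(e^{iD}W) − A(W) − ℓ_W(D) − q_W(D)` consumed by `Prop7Growth142T3Chart.le_of_taylor3_coercive_slice(_of_approxEL)`.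
[cite: Balaban1985Variational, (141)-(142) p.299] -/
theorem neg_le_wilsonAction4_expChart_sub_taylor2 (W : GaugeField (F.P K) 0 (Matrix.specialUnitaryGroup (Fin 2) ℂ)) (D : PBond (F.P K) 0 → Matrix (Fin 2) (Fin 2) ℂ)
    (hD : ∀ b : PBond (F.P K) 0, (D b).IsHermitian ∧ Matrix.trace (D b) = 0) {s : ℝ} (hs0 : 0 ≤ s) (hs : ∀ b : PBond (F.P K) 0, ‖D b‖ ≤ s)
    (hs4 : 4 * s ≤ 1) :
    -(4800 * s * ∑ b : PBond (F.P K) 0, ‖D b‖ ^ 2)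
      ≤ wilsonAction4 (emb15 W (expHermField D)) - wilsonAction4 W
        - ∑ p : Plaq (F.P K) 0, (1 / 2) * (((((GaugeField.plaqHol W p : Matrix.specialUnitaryGroup (Fin 2) ℂ) : Matrix (Fin 2) (Fin 2) ℂ) - 1)ᴴ * (((Complex.I • D ⟨p.src, p.μ⟩) + ((W ⟨p.src, p.μ⟩ : Matrix (Fin 2) (Fin 2) ℂ) * (Complex.I • D ⟨p.src.shift p.μ, p.ν⟩) * star (W ⟨p.src, p.μ⟩ : Matrix (Fin 2) (Fin 2) ℂ))
            - (((W ⟨p.src, p.μ⟩ * W ⟨p.src.shift p.μ, p.ν⟩ * (W ⟨p.src.shift p.ν, p.μ⟩)⁻¹ : Matrix.specialUnitaryGroup (Fin 2) ℂ) : Matrix (Fin 2) (Fin 2) ℂ) * (Complex.I • D ⟨p.src.shift p.ν, p.μ⟩) * star ((W ⟨p.src, p.μ⟩ * W ⟨p.src.shift p.μ, p.ν⟩ * (W ⟨p.src.shift p.ν, p.μ⟩)⁻¹ : Matrix.specialUnitaryGroup (Fin 2) ℂ) : Matrix (Fin 2) (Fin 2) ℂ))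
            - (((GaugeField.plaqHol W p : Matrix.specialUnitaryGroup (Fin 2) ℂ) : Matrix (Fin 2) (Fin 2) ℂ) * (Complex.I • D ⟨p.src, p.ν⟩) * star ((GaugeField.plaqHol W p : Matrix.specialUnitaryGroup (Fin 2) ℂ) : Matrix (Fin 2) (Fin 2) ℂ))) * ((GaugeField.plaqHol W p : Matrix.specialUnitaryGroup (Fin 2) ℂ) : Matrix (Fin 2) (Fin 2) ℂ))).trace).re
        - ∑ p : Plaq (F.P K) 0, ((1 / 2) * ‖((Complex.I • D ⟨p.src, p.μ⟩) + ((W ⟨p.src, p.μ⟩ : Matrix (Fin 2) (Fin 2) ℂ) * (Complex.I • D ⟨p.src.shift p.μ, p.ν⟩) * star (W ⟨p.src, p.μ⟩ : Matrix (Fin 2) (Fin 2) ℂ))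
            - (((W ⟨p.src, p.μ⟩ * W ⟨p.src.shift p.μ, p.ν⟩ * (W ⟨p.src.shift p.ν, p.μ⟩)⁻¹ : Matrix.specialUnitaryGroup (Fin 2) ℂ) : Matrix (Fin 2) (Fin 2) ℂ) * (Complex.I • D ⟨p.src.shift p.ν, p.μ⟩) * star ((W ⟨p.src, p.μ⟩ * W ⟨p.src.shift p.μ, p.ν⟩ * (W ⟨p.src.shift p.ν, p.μ⟩)⁻¹ : Matrix.specialUnitaryGroup (Fin 2) ℂ) : Matrix (Fin 2) (Fin 2) ℂ))
            - (((GaugeField.plaqHol W p : Matrix.specialUnitaryGroup (Fin 2) ℂ) : Matrix (Fin 2) (Fin 2) ℂ) * (Complex.I • D ⟨p.src, p.ν⟩) * star ((GaugeField.plaqHol W p : Matrix.specialUnitaryGroup (Fin 2) ℂ) : Matrix (Fin 2) (Fin 2) ℂ)))‖ ^ 2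
          + (1 / 2) * (((((GaugeField.plaqHol W p : Matrix.specialUnitaryGroup (Fin 2) ℂ) : Matrix (Fin 2) (Fin 2) ℂ) - 1)ᴴ * (((2 : ℂ)⁻¹ • ((Complex.I • D ⟨p.src, p.μ⟩) ^ 2 + ((W ⟨p.src, p.μ⟩ : Matrix (Fin 2) (Fin 2) ℂ) * (Complex.I • D ⟨p.src.shift p.μ, p.ν⟩) * star (W ⟨p.src, p.μ⟩ : Matrix (Fin 2) (Fin 2) ℂ)) ^ 2
              + (((W ⟨p.src, p.μ⟩ * W ⟨p.src.shift p.μ, p.ν⟩ * (W ⟨p.src.shift p.ν, p.μ⟩)⁻¹ : Matrix.specialUnitaryGroup (Fin 2) ℂ) : Matrix (Fin 2) (Fin 2) ℂ) * (Complex.I • D ⟨p.src.shift p.ν, p.μ⟩) * star ((W ⟨p.src, p.μ⟩ * W ⟨p.src.shift p.μ, p.ν⟩ * (W ⟨p.src.shift p.ν, p.μ⟩)⁻¹ : Matrix.specialUnitaryGroup (Fin 2) ℂ) : Matrix (Fin 2) (Fin 2) ℂ)) ^ 2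
              + (((GaugeField.plaqHol W p : Matrix.specialUnitaryGroup (Fin 2) ℂ) : Matrix (Fin 2) (Fin 2) ℂ) * (Complex.I • D ⟨p.src, p.ν⟩) * star ((GaugeField.plaqHol W p : Matrix.specialUnitaryGroup (Fin 2) ℂ) : Matrix (Fin 2) (Fin 2) ℂ)) ^ 2)
            + (Complex.I • D ⟨p.src, p.μ⟩) * ((W ⟨p.src, p.μ⟩ : Matrix (Fin 2) (Fin 2) ℂ) * (Complex.I • D ⟨p.src.shift p.μ, p.ν⟩) * star (W ⟨p.src, p.μ⟩ : Matrix (Fin 2) (Fin 2) ℂ))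
            - (Complex.I • D ⟨p.src, p.μ⟩) * (((W ⟨p.src, p.μ⟩ * W ⟨p.src.shift p.μ, p.ν⟩ * (W ⟨p.src.shift p.ν, p.μ⟩)⁻¹ : Matrix.specialUnitaryGroup (Fin 2) ℂ) : Matrix (Fin 2) (Fin 2) ℂ) * (Complex.I • D ⟨p.src.shift p.ν, p.μ⟩) * star ((W ⟨p.src, p.μ⟩ * W ⟨p.src.shift p.μ, p.ν⟩ * (W ⟨p.src.shift p.ν, p.μ⟩)⁻¹ : Matrix.specialUnitaryGroup (Fin 2) ℂ) : Matrix (Fin 2) (Fin 2) ℂ))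
            - (Complex.I • D ⟨p.src, p.μ⟩) * (((GaugeField.plaqHol W p : Matrix.specialUnitaryGroup (Fin 2) ℂ) : Matrix (Fin 2) (Fin 2) ℂ) * (Complex.I • D ⟨p.src, p.ν⟩) * star ((GaugeField.plaqHol W p : Matrix.specialUnitaryGroup (Fin 2) ℂ) : Matrix (Fin 2) (Fin 2) ℂ))
            - ((W ⟨p.src, p.μ⟩ : Matrix (Fin 2) (Fin 2) ℂ) * (Complex.I • D ⟨p.src.shift p.μ, p.ν⟩) * star (W ⟨p.src, p.μ⟩ : Matrix (Fin 2) (Fin 2) ℂ))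
                * (((W ⟨p.src, p.μ⟩ * W ⟨p.src.shift p.μ, p.ν⟩ * (W ⟨p.src.shift p.ν, p.μ⟩)⁻¹ : Matrix.specialUnitaryGroup (Fin 2) ℂ) : Matrix (Fin 2) (Fin 2) ℂ) * (Complex.I • D ⟨p.src.shift p.ν, p.μ⟩) * star ((W ⟨p.src, p.μ⟩ * W ⟨p.src.shift p.μ, p.ν⟩ * (W ⟨p.src.shift p.ν, p.μ⟩)⁻¹ : Matrix.specialUnitaryGroup (Fin 2) ℂ) : Matrix (Fin 2) (Fin 2) ℂ))
            - ((W ⟨p.src, p.μ⟩ : Matrix (Fin 2) (Fin 2) ℂ) * (Complex.I • D ⟨p.src.shift p.μ, p.ν⟩) * star (W ⟨p.src, p.μ⟩ : Matrix (Fin 2) (Fin 2) ℂ))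
                * (((GaugeField.plaqHol W p : Matrix.specialUnitaryGroup (Fin 2) ℂ) : Matrix (Fin 2) (Fin 2) ℂ) * (Complex.I • D ⟨p.src, p.ν⟩) * star ((GaugeField.plaqHol W p : Matrix.specialUnitaryGroup (Fin 2) ℂ) : Matrix (Fin 2) (Fin 2) ℂ))
            + (((W ⟨p.src, p.μ⟩ * W ⟨p.src.shift p.μ, p.ν⟩ * (W ⟨p.src.shift p.ν, p.μ⟩)⁻¹ : Matrix.specialUnitaryGroup (Fin 2) ℂ) : Matrix (Fin 2) (Fin 2) ℂ) * (Complex.I • D ⟨p.src.shift p.ν, p.μ⟩) * star ((W ⟨p.src, p.μ⟩ * W ⟨p.src.shift p.μ, p.ν⟩ * (W ⟨p.src.shift p.ν, p.μ⟩)⁻¹ : Matrix.specialUnitaryGroup (Fin 2) ℂ) : Matrix (Fin 2) (Fin 2) ℂ))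
                * (((GaugeField.plaqHol W p : Matrix.specialUnitaryGroup (Fin 2) ℂ) : Matrix (Fin 2) (Fin 2) ℂ) * (Complex.I • D ⟨p.src, p.ν⟩) * star ((GaugeField.plaqHol W p : Matrix.specialUnitaryGroup (Fin 2) ℂ) : Matrix (Fin 2) (Fin 2) ℂ))) * ((GaugeField.plaqHol W p : Matrix.specialUnitaryGroup (Fin 2) ℂ) : Matrix (Fin 2) (Fin 2) ℂ))).trace).re) :=
  (abs_le.mp (abs_wilsonAction4_expChart_sub_taylor2_le W D hD hs0 hs hs4)).1

/-! ## §7 Junction with the cell's `Y`-currency: the exact first-order functional at `Y = e^{iD} − 1` against the first differential `ℓ_W(D)` -/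

/-- `‖(A₁ + gA₂g^* − hA₃h^* − kA₄k^*) − (X₁ + gX₂g^* − hX₃h^* − kX₄k^*)‖ ≤ Σ‖A_i − X_i‖` for special unitary `g, h, k`. [folklore] -/
theorem norm_lin_sub_lin_le (g h k : Matrix.specialUnitaryGroup (Fin 2) ℂ) (A₁ A₂ A₃ A₄ X₁ X₂ X₃ X₄ : Matrix (Fin 2) (Fin 2) ℂ) :
    ‖(A₁ + (g : Matrix (Fin 2) (Fin 2) ℂ) * A₂ * star (g : Matrix (Fin 2) (Fin 2) ℂ) - (h : Matrix (Fin 2) (Fin 2) ℂ) * A₃ * star (h : Matrix (Fin 2) (Fin 2) ℂ) - (k : Matrix (Fin 2) (Fin 2) ℂ) * A₄ * star (k : Matrix (Fin 2) (Fin 2) ℂ))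
        - (X₁ + (g : Matrix (Fin 2) (Fin 2) ℂ) * X₂ * star (g : Matrix (Fin 2) (Fin 2) ℂ) - (h : Matrix (Fin 2) (Fin 2) ℂ) * X₃ * star (h : Matrix (Fin 2) (Fin 2) ℂ) - (k : Matrix (Fin 2) (Fin 2) ℂ) * X₄ * star (k : Matrix (Fin 2) (Fin 2) ℂ))‖
      ≤ ‖A₁ - X₁‖ + ‖A₂ - X₂‖ + ‖A₃ - X₃‖ + ‖A₄ - X₄‖ := by
  have e : (A₁ + (g : Matrix (Fin 2) (Fin 2) ℂ) * A₂ * star (g : Matrix (Fin 2) (Fin 2) ℂ) - (h : Matrix (Fin 2) (Fin 2) ℂ) * A₃ * star (h : Matrix (Fin 2) (Fin 2) ℂ) - (k : Matrix (Fin 2) (Fin 2) ℂ) * A₄ * star (k : Matrix (Fin 2) (Fin 2) ℂ))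
        - (X₁ + (g : Matrix (Fin 2) (Fin 2) ℂ) * X₂ * star (g : Matrix (Fin 2) (Fin 2) ℂ) - (h : Matrix (Fin 2) (Fin 2) ℂ) * X₃ * star (h : Matrix (Fin 2) (Fin 2) ℂ) - (k : Matrix (Fin 2) (Fin 2) ℂ) * X₄ * star (k : Matrix (Fin 2) (Fin 2) ℂ))
      = (A₁ - X₁) + (g : Matrix (Fin 2) (Fin 2) ℂ) * (A₂ - X₂) * star (g : Matrix (Fin 2) (Fin 2) ℂ) - (h : Matrix (Fin 2) (Fin 2) ℂ) * (A₃ - X₃) * star (h : Matrix (Fin 2) (Fin 2) ℂ) - (k : Matrix (Fin 2) (Fin 2) ℂ) * (A₄ - X₄) * star (k : Matrix (Fin 2) (Fin 2) ℂ) := by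
    noncomm_ring
  rw [e]
  refine (norm_lin_le _ _ _ _ le_rfl ?_ ?_ ?_) <;> rw [norm_conj_SU]

/-- **THE `Y`-CURRENCY JUNCTION**: for the chart point `U = e^{iD}W` (`‖D(b)‖ ≤ 1`, background plaquettes within `a` of `1`), the cell's exact first-order functional `Lin_W(Y)` at the
ACTUAL fluctuation `Y(b) = U(b)W(b)^* − 1 = e^{iD(b)} − 1` and the first differential `ℓ_W(D)` (= `Lin_W` at `Y := iD`) differ by at most `12·a·Σ_b‖D(b)‖²` (`Lin_W` is linear,
`‖Y(b) − iD(b)‖ ≤ ‖D(b)‖²`, `|½Re Tr((P₀−1)^*XP₀)| ≤ ‖P₀ − 1‖‖X‖`, incidence `4d = 12`).  Hence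
`A(e^{iD}W) − A(W) − ℓ_W(D) = [A(U) − A(W) − Lin_W(Y)] + [Lin_W(Y) − ℓ_W(D)]`: a growth bound in p1's currency (e.g. `Prop7CovariantCoercivity.wilsonAction4_sub_background_ge_offKernel_T3`
at the chosen representative) becomes the chart-level row with the approximate-EL constant `λ := 12a` of `Prop7Growth142T3Chart.growth142_T3_chart_approxEL`.
[cite: Balaban1985Variational, (141)-(143) p.299, (26)-(31) pp.282-283] -/
theorem abs_lin_pertY_sub_lin_chart_le (W : GaugeField (F.P K) 0 (Matrix.specialUnitaryGroup (Fin 2) ℂ)) (D : PBond (F.P K) 0 → Matrix (Fin 2) (Fin 2) ℂ)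
    (hD : ∀ b : PBond (F.P K) 0, (D b).IsHermitian ∧ Matrix.trace (D b) = 0) (h1 : ∀ b : PBond (F.P K) 0, ‖D b‖ ≤ 1) {a : ℝ} (ha : 0 ≤ a)
    (hW : ∀ p : Plaq (F.P K) 0, ‖((GaugeField.plaqHol W p : Matrix.specialUnitaryGroup (Fin 2) ℂ) : Matrix (Fin 2) (Fin 2) ℂ) - 1‖ ≤ a) :
    |∑ p : Plaq (F.P K) 0, (1 / 2) * (((((GaugeField.plaqHol W p : Matrix.specialUnitaryGroup (Fin 2) ℂ) : Matrix (Fin 2) (Fin 2) ℂ) - 1)ᴴ * (((((emb15 W (expHermField D) ⟨p.src, p.μ⟩ : Matrix.specialUnitaryGroup (Fin 2) ℂ) : Matrix (Fin 2) (Fin 2) ℂ) * star (W ⟨p.src, p.μ⟩ : Matrix (Fin 2) (Fin 2) ℂ) - 1)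
              + (W ⟨p.src, p.μ⟩ : Matrix (Fin 2) (Fin 2) ℂ) * (((emb15 W (expHermField D) ⟨p.src.shift p.μ, p.ν⟩ : Matrix.specialUnitaryGroup (Fin 2) ℂ) : Matrix (Fin 2) (Fin 2) ℂ) * star (W ⟨p.src.shift p.μ, p.ν⟩ : Matrix (Fin 2) (Fin 2) ℂ) - 1) * star (W ⟨p.src, p.μ⟩ : Matrix (Fin 2) (Fin 2) ℂ)
              - ((W ⟨p.src, p.μ⟩ * W ⟨p.src.shift p.μ, p.ν⟩ * (W ⟨p.src.shift p.ν, p.μ⟩)⁻¹ : Matrix.specialUnitaryGroup (Fin 2) ℂ) : Matrix (Fin 2) (Fin 2) ℂ) * (((emb15 W (expHermField D) ⟨p.src.shift p.ν, p.μ⟩ : Matrix.specialUnitaryGroup (Fin 2) ℂ) : Matrix (Fin 2) (Fin 2) ℂ) * star (W ⟨p.src.shift p.ν, p.μ⟩ : Matrix (Fin 2) (Fin 2) ℂ) - 1)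
                  * star ((W ⟨p.src, p.μ⟩ * W ⟨p.src.shift p.μ, p.ν⟩ * (W ⟨p.src.shift p.ν, p.μ⟩)⁻¹ : Matrix.specialUnitaryGroup (Fin 2) ℂ) : Matrix (Fin 2) (Fin 2) ℂ)
              - ((GaugeField.plaqHol W p : Matrix.specialUnitaryGroup (Fin 2) ℂ) : Matrix (Fin 2) (Fin 2) ℂ) * (((emb15 W (expHermField D) ⟨p.src, p.ν⟩ : Matrix.specialUnitaryGroup (Fin 2) ℂ) : Matrix (Fin 2) (Fin 2) ℂ) * star (W ⟨p.src, p.ν⟩ : Matrix (Fin 2) (Fin 2) ℂ) - 1) * star ((GaugeField.plaqHol W p : Matrix.specialUnitaryGroup (Fin 2) ℂ) : Matrix (Fin 2) (Fin 2) ℂ)) * ((GaugeField.plaqHol W p : Matrix.specialUnitaryGroup (Fin 2) ℂ) : Matrix (Fin 2) (Fin 2) ℂ))).trace).re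
        - ∑ p : Plaq (F.P K) 0, (1 / 2) * (((((GaugeField.plaqHol W p : Matrix.specialUnitaryGroup (Fin 2) ℂ) : Matrix (Fin 2) (Fin 2) ℂ) - 1)ᴴ * (((Complex.I • D ⟨p.src, p.μ⟩) + ((W ⟨p.src, p.μ⟩ : Matrix (Fin 2) (Fin 2) ℂ) * (Complex.I • D ⟨p.src.shift p.μ, p.ν⟩) * star (W ⟨p.src, p.μ⟩ : Matrix (Fin 2) (Fin 2) ℂ))
            - (((W ⟨p.src, p.μ⟩ * W ⟨p.src.shift p.μ, p.ν⟩ * (W ⟨p.src.shift p.ν, p.μ⟩)⁻¹ : Matrix.specialUnitaryGroup (Fin 2) ℂ) : Matrix (Fin 2) (Fin 2) ℂ) * (Complex.I • D ⟨p.src.shift p.ν, p.μ⟩) * star ((W ⟨p.src, p.μ⟩ * W ⟨p.src.shift p.μ, p.ν⟩ * (W ⟨p.src.shift p.ν, p.μ⟩)⁻¹ : Matrix.specialUnitaryGroup (Fin 2) ℂ) : Matrix (Fin 2) (Fin 2) ℂ))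
            - (((GaugeField.plaqHol W p : Matrix.specialUnitaryGroup (Fin 2) ℂ) : Matrix (Fin 2) (Fin 2) ℂ) * (Complex.I • D ⟨p.src, p.ν⟩) * star ((GaugeField.plaqHol W p : Matrix.specialUnitaryGroup (Fin 2) ℂ) : Matrix (Fin 2) (Fin 2) ℂ))) * ((GaugeField.plaqHol W p : Matrix.specialUnitaryGroup (Fin 2) ℂ) : Matrix (Fin 2) (Fin 2) ℂ))).trace).re|
      ≤ 12 * a * ∑ b : PBond (F.P K) 0, ‖D b‖ ^ 2 := by
  rw [← Finset.sum_sub_distrib]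
  refine (Finset.abs_sum_le_sum_abs _ _).trans ?_
  have hinc := sum_plaq_bonds_le (P := F.P K) (j := 0) (fun b => ‖D b‖ ^ 2) (fun b => sq_nonneg _)
  have hd : ((F.P K).d : ℝ) = 3 := by norm_num [T3Family.P_d]
  rw [hd] at hinc
  have hY : ∀ b : PBond (F.P K) 0, ‖(((emb15 W (expHermField D) b : Matrix.specialUnitaryGroup (Fin 2) ℂ) : Matrix (Fin 2) (Fin 2) ℂ) * star (W b : Matrix (Fin 2) (Fin 2) ℂ) - 1) - Complex.I • D b‖ ≤ ‖D b‖ ^ 2 :=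
    fun b => Prop7Taylor3ExpChart.norm_pertY_sub_lin_le W D b (hD b) (h1 b)
  refine (Finset.sum_le_sum (g := fun p : Plaq (F.P K) 0 => a * (‖D ⟨p.src, p.μ⟩‖ ^ 2 + ‖D ⟨p.src.shift p.μ, p.ν⟩‖ ^ 2 + ‖D ⟨p.src.shift p.ν, p.μ⟩‖ ^ 2 + ‖D ⟨p.src, p.ν⟩‖ ^ 2))
    fun p _ => ?_).trans ?_
  · refine (abs_half_re_trace_sub_le _ _ _ (GaugeField.plaqHol W p).2.1).trans ?_
    have hn := norm_lin_sub_lin_le (W ⟨p.src, p.μ⟩) (W ⟨p.src, p.μ⟩ * W ⟨p.src.shift p.μ, p.ν⟩ * (W ⟨p.src.shift p.ν, p.μ⟩)⁻¹) (GaugeField.plaqHol W p)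
      (((emb15 W (expHermField D) ⟨p.src, p.μ⟩ : Matrix.specialUnitaryGroup (Fin 2) ℂ) : Matrix (Fin 2) (Fin 2) ℂ) * star (W ⟨p.src, p.μ⟩ : Matrix (Fin 2) (Fin 2) ℂ) - 1) (((emb15 W (expHermField D) ⟨p.src.shift p.μ, p.ν⟩ : Matrix.specialUnitaryGroup (Fin 2) ℂ) : Matrix (Fin 2) (Fin 2) ℂ) * star (W ⟨p.src.shift p.μ, p.ν⟩ : Matrix (Fin 2) (Fin 2) ℂ) - 1)
      (((emb15 W (expHermField D) ⟨p.src.shift p.ν, p.μ⟩ : Matrix.specialUnitaryGroup (Fin 2) ℂ) : Matrix (Fin 2) (Fin 2) ℂ) * star (W ⟨p.src.shift p.ν, p.μ⟩ : Matrix (Fin 2) (Fin 2) ℂ) - 1) (((emb15 W (expHermField D) ⟨p.src, p.ν⟩ : Matrix.specialUnitaryGroup (Fin 2) ℂ) : Matrix (Fin 2) (Fin 2) ℂ) * star (W ⟨p.src, p.ν⟩ : Matrix (Fin 2) (Fin 2) ℂ) - 1)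
      (Complex.I • D ⟨p.src, p.μ⟩) (Complex.I • D ⟨p.src.shift p.μ, p.ν⟩) (Complex.I • D ⟨p.src.shift p.ν, p.μ⟩) (Complex.I • D ⟨p.src, p.ν⟩)
    refine (mul_le_mul (hW p) (hn.trans (add_le_add (add_le_add (add_le_add (hY _) (hY _)) (hY _)) (hY _))) (norm_nonneg _) ha).trans ?_
    exact le_rfl
  · rw [← Finset.mul_sum]
    have := mul_le_mul_of_nonneg_left hinc ha
    linarith

end Action

end Summit.QuantumFields.YangMills.Theorems.Prop7Taylor3Word

end
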